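/- Width seat 2/3 `ym-line-cbag-p1-w2` (prover-ym-line-cbag-p1-w2-g20-0) of the cell of ideator ym-idea-2, LINE 8
(route `EguchiKawaiDirectionLadder`), post-closure glue toward the STRONG-COUPLING side of the barrier entry
`EguchiKawaiBreakdown`: the one-link Bakry–Émery Poincaré inequality on `SU(N)` for a GENERAL smooth tilt `e^S dσ` under a
curvature-dimension hypothesis `K Γ ≤ Γ₂^S` (the tree's `SUNBakryEmery` Parts D/E are typed for the linear tilt `c Re tr(· B)`
only).  Part 1/3: the integrated Bochner inequality and the Poincaré inequality from approximate solvability.  Route-independent;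
YM mass gap NOT touched (barrier-ledger line). -/
import Literature.MathematicalPhysics.QuantumFieldTheory.SUNBakryEmeryPoincare
import HarnessLib

/-!
# Bakry–Émery on `SU(N)` for a general tilt, I: integrated `Γ₂ ≥ K Γ` and Poincaré from approximate solvability

The tree file `Literature/MathematicalPhysics/QuantumFieldTheory/SUNBakryEmeryPoincare.lean` (namespace `SUNBakryEmery`) proves
the Poincaré inequality of the one-link Gibbs measure `e^{S} dσ` on `SU(N)` for the LINEAR potential `S = pot c B = c Re tr(· B)`,
`K = N/2 − |c| ‖B‖_op` (`poincare_pot`).  Its Parts D/E (integration by parts, symmetry of `L_S = Δ + Γ(S,·)`, the integrated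
Bochner formula `∫ e^S (L_S u)² = ∫ e^S Γ₂^S(u)`) are already stated for an arbitrary smooth `S`; only the USE of the curvature bound
`Γ₂^S(u) ≥ K Γ(u,u)` is hard-wired to `pot c B` (`Gam2_potential_ge`).  This file re-derives the two Part-D/E conclusions for an
arbitrary smooth `S : M_N(ℂ) → ℝ` under the explicit curvature-dimension hypothesis

  `hCD : ∀ u smooth, ∀ g ∈ SU(N), K · Γ(u,u)(g) ≤ Γ₂^S(u)(g)`   (Bakry–Émery `CD(K,∞)` on `SU(N)` for `L_S`):

* `integral_exp_mul_Gam_le_of_cd` : `K ∫ e^S Γ(u,u) dσ ≤ ∫ e^S (L_S u)² dσ`;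
* `poincare_of_approx_of_cd` : if smooth `v_k` solve the Poisson equation `L_S v = u − m` approximately in `L²(e^S σ)`, then
  `K ∫ e^S (u − m)² dσ ≤ ∫ e^S Γ(u,u) dσ` (the duality argument of `SUNBakryEmery.poincare_of_approx`, verbatim with `pot c B ↦ S`).

Parts II/III (`…PolyTiltPoincareProjection`, `…PolyTiltPoincare`) supply approximate solvability for POLYNOMIAL `S` and conclude the
Poincaré inequality; `…QuadraticTiltCurvature` proves `hCD` for the quadratic tilts `Σ cᵢ Re tr(Q Aᵢ Qᴴ Cᵢ)` of the Eguchi–Kawai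
single-site model, and `…StrongCouplingSymmetry` applies it (EK centre symmetry unbroken at strong coupling).

References: D. Bakry, M. Émery, Sém. Probab. XIX, LNM 1123 (1985) 177–206; Bakry–Gentil–Ledoux, Grundlehren 348 (2014) Prop. 4.8.1;
H. Shen, R. Zhu, X. Zhu, CMP 400 (2023) 805–851, §4.1 (the `SU(N)` computation).  HONEST FRAMING: functional-inequality
infrastructure; no statement about Yang–Mills, no mass gap, no summit statement is proved or advanced here.
-/

set_option autoImplicit false

noncomputable section

open scoped Matrix Matrix.Norms.Frobenius ContDiff Topology
open MeasureTheory Filter Finset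
open Literature.MathematicalPhysics.QuantumFieldTheory
open Literature.MathematicalPhysics.QuantumFieldTheory.SUNBakryEmery

namespace Summit.QuantumFields.YangMills.Theorems.EguchiKawaiDirectionLadder

variable {N : ℕ}

/-- `Γ₂^S(u)` is smooth for smooth `S`, `u` (it is `½ L_S Γ(u,u) − Γ(u, L_S u)`). -/
theorem contDiff_Gam2 {S u : Matrix (Fin N) (Fin N) ℂ → ℝ} (hS : ContDiff ℝ ∞ S) (hu : ContDiff ℝ ∞ u) :
    ContDiff ℝ ∞ (Gam2 S u) := by
  have : Gam2 S u = fun Q => (1 / 2) * genL S (Gam u u) Q - Gam u (genL S u) Q := rfl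
  rw [this]
  exact (contDiff_const.mul (contDiff_genL hS (contDiff_Gam hu hu))).sub (contDiff_Gam hu (contDiff_genL hS hu))

/-- **Integrated curvature-dimension inequality under `CD(K,∞)`**: if `K Γ(u,u) ≤ Γ₂^S(u)` on `SU(N)` for every smooth `u`,
then `K ∫ e^S Γ(u,u) dσ ≤ ∫ e^S (L_S u)² dσ` (integrated Bochner formula `∫ e^S (L_S u)² = ∫ e^S Γ₂^S(u)` of the tree).
Bakry–Émery 1985; Shen–Zhu–Zhu (4.7) for one link. -/
theorem integral_exp_mul_Gam_le_of_cd (hN : N ≠ 0) {S : Matrix (Fin N) (Fin N) ℂ → ℝ} (hS : ContDiff ℝ ∞ S) {K : ℝ}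
    (hCD : ∀ u : Matrix (Fin N) (Fin N) ℂ → ℝ, ContDiff ℝ ∞ u → ∀ g : SUN N,
      K * Gam u u (g : Matrix (Fin N) (Fin N) ℂ) ≤ Gam2 S u (g : Matrix (Fin N) (Fin N) ℂ))
    {u : Matrix (Fin N) (Fin N) ℂ → ℝ} (hu : ContDiff ℝ ∞ u) :
    K * ∫ g : SUN N, Real.exp (S g) * Gam u u g ∂(haarSU N) ≤
      ∫ g : SUN N, Real.exp (S g) * genL S u g ^ 2 ∂(haarSU N) := by
  rw [show haarSU N = haarProbability (SUN N) from rfl, integral_exp_mul_genL_sq hN hS hu, ← integral_const_mul]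
  refine integral_mono ?_ ?_ fun g => ?_
  · exact (integrable_of_continuous_SUN (continuous_restrict (hS.exp.mul (contDiff_Gam hu hu))) _).const_mul _
  · exact integrable_of_continuous_SUN (continuous_restrict (hS.exp.mul (contDiff_Gam2 hS hu))) _
  · have h := hCD u hu g
    have hpos := Real.exp_pos (S g)
    calc K * (Real.exp (S g) * Gam u u g) = Real.exp (S g) * (K * Gam u u g) := by ring
      _ ≤ Real.exp (S g) * Gam2 S u g := mul_le_mul_of_nonneg_left h hpos.le

/-- **Poincaré inequality from approximate solvability of the Poisson equation, under `CD(K,∞)`** (the duality argument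
of `SUNBakryEmery.poincare_of_approx` for a general smooth tilt): `S` smooth with `K Γ ≤ Γ₂^S` on `SU(N)`, `K > 0`, `u` smooth,
`m` a constant, and smooth `v_k` with `∫ e^S (L_S v_k − (u − m))² dσ → 0`; then `K ∫ e^S (u − m)² dσ ≤ ∫ e^S Γ(u,u) dσ`.
Proof: `‖u₀‖² = −∫ e^S Γ(u, v_k) + ⟨u₀, u₀ − L v_k⟩`, Cauchy–Schwarz, and `K ∫ e^S Γ(v_k,v_k) ≤ ∫ e^S (L v_k)²`. -/
theorem poincare_of_approx_of_cd (hN : N ≠ 0) {S : Matrix (Fin N) (Fin N) ℂ → ℝ} (hS : ContDiff ℝ ∞ S) {K : ℝ}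
    (hK : 0 < K)
    (hCD : ∀ u : Matrix (Fin N) (Fin N) ℂ → ℝ, ContDiff ℝ ∞ u → ∀ g : SUN N,
      K * Gam u u (g : Matrix (Fin N) (Fin N) ℂ) ≤ Gam2 S u (g : Matrix (Fin N) (Fin N) ℂ))
    {u : Matrix (Fin N) (Fin N) ℂ → ℝ} (hu : ContDiff ℝ ∞ u) (m : ℝ)
    (v : ℕ → Matrix (Fin N) (Fin N) ℂ → ℝ) (hv : ∀ k, ContDiff ℝ ∞ (v k))
    (hconv : Tendsto (fun k => ∫ g : SUN N, Real.exp (S g) * (genL S (v k) g - (u g - m)) ^ 2 ∂(haarSU N)) atTop (𝓝 0)) :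
    K * ∫ g : SUN N, Real.exp (S g) * (u g - m) ^ 2 ∂(haarSU N) ≤
      ∫ g : SUN N, Real.exp (S g) * Gam u u g ∂(haarSU N) := by
  set σ := haarSU N with hσ
  have hSc : Continuous fun g : SUN N => S g := continuous_restrict hS
  have hu0 : ContDiff ℝ ∞ (fun Q => u Q - m) := hu.sub contDiff_const
  -- the quantities
  set A : ℝ := ∫ g : SUN N, Real.exp (S g) * (u g - m) ^ 2 ∂σ with hAdef
  set G : ℝ := ∫ g : SUN N, Real.exp (S g) * Gam u u g ∂σ with hGdef
  set e : ℕ → ℝ := fun k => ∫ g : SUN N, Real.exp (S g) * (genL S (v k) g - (u g - m)) ^ 2 ∂σ with hedef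
  have hA0 : 0 ≤ A := integral_nonneg fun g => mul_nonneg (Real.exp_pos _).le (sq_nonneg _)
  have hG0 : 0 ≤ G := integral_nonneg fun g => mul_nonneg (Real.exp_pos _).le (Gam_self_nonneg _ _)
  have he0 : ∀ k, 0 ≤ e k := fun k => integral_nonneg fun g => mul_nonneg (Real.exp_pos _).le (sq_nonneg _)
  -- the key estimate for each `k`
  have hkey : ∀ k, A ≤ Real.sqrt (G / K) * (Real.sqrt A + Real.sqrt (e k)) + Real.sqrt A * Real.sqrt (e k) := by
    intro k
    have hvk := hv k
    have hLc : Continuous fun g : SUN N => genL S (v k) g := continuous_restrict (contDiff_genL hS hvk)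
    have huc : Continuous fun g : SUN N => u g - m := continuous_restrict hu0
    have hwc : Continuous fun g : SUN N => Real.exp (S g) := Real.continuous_exp.comp hSc
    -- Step 1: `A = ∫ w (u-m) L v_k + ∫ w (u-m) ((u-m) - L v_k)`
    have i1 : Integrable (fun g : SUN N => Real.exp (S g) * ((u g - m) * genL S (v k) g)) σ :=
      integrable_of_continuous_SUN (hwc.mul (huc.mul hLc)) σ
    have i2 : Integrable (fun g : SUN N => Real.exp (S g) * ((u g - m) * ((u g - m) - genL S (v k) g))) σ :=
      integrable_of_continuous_SUN (hwc.mul (huc.mul (huc.sub hLc))) σ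
    have hsplit : A = ∫ g : SUN N, Real.exp (S g) * ((u g - m) * genL S (v k) g) ∂σ +
        ∫ g : SUN N, Real.exp (S g) * ((u g - m) * ((u g - m) - genL S (v k) g)) ∂σ := by
      rw [← integral_add i1 i2]
      refine integral_congr_ae (ae_of_all _ fun g => ?_)
      ring
    -- Step 2: `∫ w (u-m) L v_k = -∫ w Γ(u, v_k)`
    have hstep2 : ∫ g : SUN N, Real.exp (S g) * ((u g - m) * genL S (v k) g) ∂σ =
        -∫ g : SUN N, Real.exp (S g) * Gam u (v k) g ∂σ := by
      have h1 := integral_mul_exp_mul_genL hN hS hu hvk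
      have h2 := integral_exp_mul_genL_eq_zero hN hS hvk
      rw [show haarProbability (SUN N) = σ from rfl] at h1 h2
      have : ∫ g : SUN N, Real.exp (S g) * ((u g - m) * genL S (v k) g) ∂σ =
          ∫ g : SUN N, u g * (Real.exp (S g) * genL S (v k) g) ∂σ -
            m * ∫ g : SUN N, Real.exp (S g) * genL S (v k) g ∂σ := by
        have i3 : Integrable (fun g : SUN N => u g * (Real.exp (S g) * genL S (v k) g)) σ :=
          integrable_of_continuous_SUN ((continuous_restrict hu).mul (hwc.mul hLc)) σ
        have i4 : Integrable (fun g : SUN N => m * (Real.exp (S g) * genL S (v k) g)) σ :=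
          (integrable_of_continuous_SUN (hwc.mul hLc) σ).const_mul m
        rw [← integral_const_mul, ← integral_sub i3 i4]
        refine integral_congr_ae (ae_of_all _ fun g => ?_)
        ring
      rw [this, h1, h2, mul_zero, sub_zero]
    -- Step 3 & 4: `|∫ w Γ(u,v_k)| ≤ √G √(∫ w Γ(v_k,v_k)) ≤ √G √((1/K) ∫ w (L v_k)²)`
    have hstep3 := abs_integral_exp_mul_Gam_le hS hu hvk σ
    have hstep4 : ∫ g : SUN N, Real.exp (S g) * Gam (v k) (v k) g ∂σ ≤
        (1 / K) * ∫ g : SUN N, Real.exp (S g) * genL S (v k) g ^ 2 ∂σ := by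
      have h := integral_exp_mul_Gam_le_of_cd hN hS hCD hvk
      rw [one_div, ← div_eq_inv_mul, le_div_iff₀ hK, mul_comm]
      exact h
    -- Step 5: `|∫ w (u-m)((u-m) - L v_k)| ≤ √A √(e k)`
    have hstep5 : |∫ g : SUN N, Real.exp (S g) * ((u g - m) * ((u g - m) - genL S (v k) g)) ∂σ| ≤
        Real.sqrt A * Real.sqrt (e k) := by
      have h := abs_integral_exp_mul_mul_le (f := fun g : SUN N => u g - m)
        (g := fun g : SUN N => (u g - m) - genL S (v k) g) hSc huc (huc.sub hLc) σ
      have : ∫ g : SUN N, Real.exp (S g) * ((u g - m) - genL S (v k) g) ^ 2 ∂σ = e k := by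
        simp only [hedef]
        refine integral_congr_ae (ae_of_all _ fun g => ?_)
        ring
      rwa [this] at h
    -- Step 6: `∫ w (L v_k)² ≤ (√A + √(e k))²`
    have hstep6 : ∫ g : SUN N, Real.exp (S g) * genL S (v k) g ^ 2 ∂σ ≤ (Real.sqrt A + Real.sqrt (e k)) ^ 2 := by
      have hcs := abs_integral_exp_mul_mul_le (f := fun g : SUN N => u g - m)
        (g := fun g : SUN N => genL S (v k) g - (u g - m)) hSc huc (hLc.sub huc) σ
      have hek : ∫ g : SUN N, Real.exp (S g) * (genL S (v k) g - (u g - m)) ^ 2 ∂σ = e k := rfl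
      rw [hek] at hcs
      have hexp : ∫ g : SUN N, Real.exp (S g) * genL S (v k) g ^ 2 ∂σ =
          A + 2 * ∫ g : SUN N, Real.exp (S g) * ((u g - m) * (genL S (v k) g - (u g - m))) ∂σ +
            ∫ g : SUN N, Real.exp (S g) * (genL S (v k) g - (u g - m)) ^ 2 ∂σ := by
        have j1 : Integrable (fun g : SUN N => Real.exp (S g) * (u g - m) ^ 2) σ :=
          integrable_of_continuous_SUN (hwc.mul (huc.pow 2)) σ
        have j2 : Integrable (fun g : SUN N => 2 * (Real.exp (S g) * ((u g - m) * (genL S (v k) g - (u g - m))))) σ :=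
          (integrable_of_continuous_SUN (hwc.mul (huc.mul (hLc.sub huc))) σ).const_mul 2
        have j12 : Integrable (fun g : SUN N => Real.exp (S g) * (u g - m) ^ 2 +
            2 * (Real.exp (S g) * ((u g - m) * (genL S (v k) g - (u g - m))))) σ := j1.add j2
        have j3 : Integrable (fun g : SUN N => Real.exp (S g) * (genL S (v k) g - (u g - m)) ^ 2) σ :=
          integrable_of_continuous_SUN (hwc.mul ((hLc.sub huc).pow 2)) σ
        rw [← integral_const_mul, hAdef, ← integral_add j1 j2, ← integral_add j12 j3]
        refine integral_congr_ae (ae_of_all _ fun g => ?_)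
        ring
      have hek : ∫ g : SUN N, Real.exp (S g) * (genL S (v k) g - (u g - m)) ^ 2 ∂σ = e k := rfl
      rw [hexp, hek, add_sq, Real.sq_sqrt hA0, Real.sq_sqrt (he0 k)]
      have := (abs_le.1 hcs).2
      nlinarith
    -- combine
    have h34 : |∫ g : SUN N, Real.exp (S g) * Gam u (v k) g ∂σ| ≤
        Real.sqrt G * Real.sqrt ((1 / K) * (Real.sqrt A + Real.sqrt (e k)) ^ 2) := by
      refine hstep3.trans (mul_le_mul_of_nonneg_left (Real.sqrt_le_sqrt (hstep4.trans ?_)) (Real.sqrt_nonneg _))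
      exact mul_le_mul_of_nonneg_left hstep6 (by positivity)
    have hsqrt : Real.sqrt ((1 / K) * (Real.sqrt A + Real.sqrt (e k)) ^ 2) =
        Real.sqrt (1 / K) * (Real.sqrt A + Real.sqrt (e k)) := by
      rw [Real.sqrt_mul (by positivity), Real.sqrt_sq (by positivity)]
    rw [hsqrt] at h34
    have hGK : Real.sqrt G * (Real.sqrt (1 / K) * (Real.sqrt A + Real.sqrt (e k))) =
        Real.sqrt (G / K) * (Real.sqrt A + Real.sqrt (e k)) := by
      rw [← mul_assoc, ← Real.sqrt_mul hG0, ← div_eq_mul_one_div]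
    rw [hGK] at h34
    have h2' := (abs_le.1 h34).1
    have h5' := (abs_le.1 hstep5).2
    linarith [hsplit, hstep2, h2', h5']
  -- pass to the limit `e k → 0`
  have hlim : Tendsto (fun k => Real.sqrt (G / K) * (Real.sqrt A + Real.sqrt (e k)) + Real.sqrt A * Real.sqrt (e k))
      atTop (𝓝 (Real.sqrt (G / K) * (Real.sqrt A + Real.sqrt 0) + Real.sqrt A * Real.sqrt 0)) := by
    have hse : Tendsto (fun k => Real.sqrt (e k)) atTop (𝓝 (Real.sqrt 0)) :=
      (Real.continuous_sqrt.tendsto 0).comp hconv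
    exact ((tendsto_const_nhds.add hse).const_mul _).add (hse.const_mul _)
  rw [Real.sqrt_zero, add_zero, mul_zero, add_zero] at hlim
  have hAle : A ≤ Real.sqrt (G / K) * Real.sqrt A := ge_of_tendsto' hlim hkey
  -- `A ≤ √(G/K) √A ⇒ K A ≤ G`
  by_cases hA1 : Real.sqrt A = 0
  · have : A = 0 := by rwa [Real.sqrt_eq_zero hA0] at hA1
    rw [this, mul_zero]; exact hG0
  · have hsApos : 0 < Real.sqrt A := lt_of_le_of_ne (Real.sqrt_nonneg A) (Ne.symm hA1)
    have h1 : Real.sqrt A * Real.sqrt A ≤ Real.sqrt (G / K) * Real.sqrt A := by rwa [Real.mul_self_sqrt hA0]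
    have h2 : Real.sqrt A ≤ Real.sqrt (G / K) := le_of_mul_le_mul_right h1 hsApos
    have h3 : A ≤ G / K := by
      calc A = Real.sqrt A ^ 2 := (Real.sq_sqrt hA0).symm
        _ ≤ Real.sqrt (G / K) ^ 2 := pow_le_pow_left₀ (Real.sqrt_nonneg A) h2 2
        _ = G / K := Real.sq_sqrt (div_nonneg hG0 hK.le)
    rwa [le_div_iff₀ hK, mul_comm] at h3

end Summit.QuantumFields.YangMills.Theorems.EguchiKawaiDirectionLadder
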